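import Literature.Analysis.Fourier.QuarterWaveParseval

/-!
# Parseval on a half period: `∫₀¹ u·v̄ = ½ Σ_{ξ∈ℤ} û(ξ)·conj v̂(ξ)` with `û(ξ) = ∫₀¹ u(x)e^{-iπξx} dx`

Topic `Literature/Analysis/Fourier`. A function on `[0,1]`, extended by ZERO to the cell `(0,2]`, is
a function on a period of the exponentials `e^{iπξx}` (`ξ ∈ ℤ`, period `2`), and `{e^{iπξx}/√2}_{ξ∈ℤ}`
is a complete orthonormal system of `L²(0,2)`. Hence for `u, v ∈ L²(0,1)` the **half-period Fourier
coefficients at INTEGER frequencies**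

  `û(ξ) := hpCoeff u ξ = ∫₀¹ u(x) · e^{-iπξx} dx`   (`ξ ∈ ℤ`)

satisfy Parseval's identity in the form

* `hasSum_sq_hpCoeff` : `Σ_{ξ∈ℤ} ‖û(ξ)‖² = 2·∫₀¹ ‖u‖²` (as a `HasSum`; `tsum_sq_hpCoeff`), and its
  POLARISED form
* `hasSum_hpCoeff_mul_conj` : `Σ_{ξ∈ℤ} û(ξ)·conj v̂(ξ) = 2·∫₀¹ u·conj v` (`tsum_hpCoeff_mul_conj`),

for `u, v : ℝ → ℂ` measurable with `∫₀¹ ‖u‖², ∫₀¹ ‖v‖² < ∞` (the values off `[0,1]` never enter). The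
family `{e^{iπξx}}` restricted to `[0,1]` is NOT orthogonal there (it is an overcomplete frame of
`L²(0,1)` with frame constant `2`): the identity is Parseval on `(0,2]` for the zero extension `hpExt u`,
i.e. Mathlib's `hasSum_sq_fourierCoeffOn` on `AddCircle 2`, plus `fourierCoeffOn (hpExt u) ξ = ½ û(ξ)`
(`fourierCoeffOn_hpExt`); the polarised form follows from the squared one by the polarisation identity
`a·b̄ = ¼[(|a+b|² − |a−b|²) + i(|a+ib|² − |a−ib|²)]` applied to the coefficients and to the integrand.

Why formalised (cell landau-siegel, §E row E-102, desk notes HOME/ls-Bdet-typer-2/parseval/PARSEVAL-C2.md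
and HOME/ls-Bdet-typer-1/E102-LINEB-PARSEVAL-NOTE.md): for profiles supported in `[0,1]` the quadratic
forms of Zhang-type main terms (`Literature/NumberTheory/LFunctions/Zhang2022/DetectorMainTermForm.lean`,
formula I) become EXACT sums over the integer frequency lattice, where their bulk symbol is a polynomial
whose sign on `ℤ` is the cell's sign-admissibility / anchor condition. This file is the transfer lemma
only (P1 of that programme); nothing about those forms is stated here.

Source: Y. Katznelson, *An Introduction to Harmonic Analysis* (3rd ed., 2004), Ch. I §5: Lemma 5.4 (Parseval,
polarised form in a Hilbert space) and Theorem 5.5 (the exponentials are a complete orthonormal system of `L²(𝕋)`;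
`Σ|f̂(n)|² = (1/2π)∫|f|²`) [Katznelson2004] — here transported to the period-`2` circle and a function supported
on half of it; elementary plumbing is tagged [folklore] and kept private;
template `Literature/Analysis/Fourier/QuarterWaveParseval.lean` (same method with an odd/even extension
to a period-`4` cell).
-/

noncomputable section

open MeasureTheory Set intervalIntegral Complex
open scoped Real ComplexConjugate

namespace Literature.Analysis.Fourier

/-! ### The half-period kernel, coefficients and the zero extension -/

/-- The kernel `e^{-iπξx}` of the half-period coefficient at integer frequency `ξ` (the character
`fourier (-ξ)` of `AddCircle 2` at `↑x`, `fourier_neg_coe_eq_hpKer`). [folklore] -/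
def hpKer (ξ : ℤ) (x : ℝ) : ℂ := Complex.exp (-((π : ℂ) * I * ξ * x))

/-- **The half-period Fourier coefficient** `û(ξ) = ∫₀¹ u(x) e^{-iπξx} dx` of `u : ℝ → ℂ` at the integer
frequency `ξ` (period-`2` exponentials seen on `[0,1]`; `f̂(n) = ⟨f, e^{int}⟩` of Thm 5.5 up to the period
normalisation). [cite: Katznelson2004, Ch. I §5.5] -/
def hpCoeff (u : ℝ → ℂ) (ξ : ℤ) : ℂ := ∫ x in (0:ℝ)..1, u x * hpKer ξ x

/-- The ZERO extension of `u|(−∞,1]` to the right: `u` for `x ≤ 1`, `0` for `x > 1` (on the period cell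
`(0,2]` this is `u·1_{(0,1]}`). [folklore] -/
def hpExt (u : ℝ → ℂ) (x : ℝ) : ℂ := if x ≤ 1 then u x else 0

variable {u v : ℝ → ℂ}

/-- The kernel is continuous. [cite: Katznelson2004, Ch. I §5.5] -/
theorem continuous_hpKer (ξ : ℤ) : Continuous (hpKer ξ) := by
  unfold hpKer
  fun_prop

/-- The kernel is unimodular: `‖e^{-iπξx}‖ = 1`. [cite: Katznelson2004, Ch. I §5.5] -/
theorem norm_hpKer (ξ : ℤ) (x : ℝ) : ‖hpKer ξ x‖ = 1 := by
  rw [hpKer, Complex.norm_exp]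
  simp

/-- Mathlib's character `fourier (-ξ)` of `AddCircle (2 - 0)` at `↑x` is `e^{-iπξx}` (the orthonormal system of Thm 5.5 on the period-`2` circle). [cite: Katznelson2004, Ch. I §5.5] -/
theorem fourier_neg_coe_eq_hpKer (ξ : ℤ) (x : ℝ) :
    fourier (-ξ) ((x : ℝ) : AddCircle ((2:ℝ) - 0)) = hpKer ξ x := by
  rw [fourier_coe_apply, hpKer]
  congr 1
  push_cast
  ring

/-- On `x ≤ 1` the extension is `u`. [folklore] -/
private theorem hpExt_of_le_one {x : ℝ} (hx : x ≤ 1) : hpExt u x = u x := by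
  simp [hpExt, hx]

/-- On `x > 1` the extension vanishes. [folklore] -/
private theorem hpExt_of_one_lt {x : ℝ} (hx : 1 < x) : hpExt u x = 0 := by
  simp [hpExt, not_le.mpr hx]

/-- `hpExt u` is measurable when `u` is. [cite: Katznelson2004, Ch. I §5.5] -/
theorem measurable_hpExt (hu : Measurable u) : Measurable (hpExt u) := by
  unfold hpExt
  exact Measurable.ite measurableSet_Iic hu measurable_const

/-! ### Elementary properties of the coefficients -/

/-- `u ↦ û(ξ)` is additive (for integrable `u, v`). [cite: Katznelson2004, Ch. I §5, Lemma 5.4 (Parseval) and Thm 5.5] -/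
theorem hpCoeff_add (hu : IntervalIntegrable u volume 0 1) (hv : IntervalIntegrable v volume 0 1)
    (ξ : ℤ) : hpCoeff (fun x => u x + v x) ξ = hpCoeff u ξ + hpCoeff v ξ := by
  unfold hpCoeff
  rw [← intervalIntegral.integral_add (hu.mul_continuousOn (continuous_hpKer ξ).continuousOn)
    (hv.mul_continuousOn (continuous_hpKer ξ).continuousOn)]
  refine intervalIntegral.integral_congr fun x _ => ?_
  simp only
  ring

/-- `u ↦ û(ξ)` respects subtraction (for integrable `u, v`). [cite: Katznelson2004, Ch. I §5, Lemma 5.4 (Parseval) and Thm 5.5] -/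
theorem hpCoeff_sub (hu : IntervalIntegrable u volume 0 1) (hv : IntervalIntegrable v volume 0 1)
    (ξ : ℤ) : hpCoeff (fun x => u x - v x) ξ = hpCoeff u ξ - hpCoeff v ξ := by
  unfold hpCoeff
  rw [← intervalIntegral.integral_sub (hu.mul_continuousOn (continuous_hpKer ξ).continuousOn)
    (hv.mul_continuousOn (continuous_hpKer ξ).continuousOn)]
  refine intervalIntegral.integral_congr fun x _ => ?_
  simp only
  ring

/-- `u ↦ û(ξ)` is homogeneous: `(c·u)^(ξ) = c·û(ξ)`. [cite: Katznelson2004, Ch. I §5, Lemma 5.4 (Parseval) and Thm 5.5] -/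
theorem hpCoeff_const_mul (c : ℂ) (u : ℝ → ℂ) (ξ : ℤ) :
    hpCoeff (fun x => c * u x) ξ = c * hpCoeff u ξ := by
  unfold hpCoeff
  rw [← intervalIntegral.integral_const_mul]
  refine intervalIntegral.integral_congr fun x _ => ?_
  simp only
  ring

/-! ### The zero extension on the period cell `(0, 2]` -/

/-- Integrating a continuous `g` against `hpExt u` over `(0,2]` = integrating against `u` over `(0,1]` (the zero
extension seen on the period cell). [cite: Katznelson2004, Ch. I §5.5] -/
theorem integral_mul_hpExt (g : ℝ → ℂ) (hg : Continuous g) (hu : IntervalIntegrable u volume 0 1) :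
    ∫ x in (0:ℝ)..2, g x * hpExt u x = ∫ x in (0:ℝ)..1, g x * u x := by
  have h01 : IntervalIntegrable (fun x => g x * hpExt u x) volume 0 1 := by
    have h : IntervalIntegrable (fun x => g x * u x) volume 0 1 :=
      hu.continuousOn_mul hg.continuousOn
    refine (intervalIntegrable_iff.2 ((intervalIntegrable_iff.1 h).congr_fun (fun x hx => ?_)
      measurableSet_uIoc))
    rw [uIoc_of_le zero_le_one] at hx
    simp only [hpExt_of_le_one hx.2]
  have h12 : IntervalIntegrable (fun x => g x * hpExt u x) volume 1 2 := by
    refine (intervalIntegrable_iff.2 ((intervalIntegrable_iff.1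
      (intervalIntegrable_const (c := (0:ℂ)))).congr_fun (fun x hx => ?_) measurableSet_uIoc))
    rw [uIoc_of_le one_le_two] at hx
    simp only [hpExt_of_one_lt hx.1, mul_zero]
  rw [← intervalIntegral.integral_add_adjacent_intervals h01 h12]
  have e1 : ∫ x in (0:ℝ)..1, g x * hpExt u x = ∫ x in (0:ℝ)..1, g x * u x := by
    rw [intervalIntegral.integral_of_le zero_le_one, intervalIntegral.integral_of_le zero_le_one]
    refine setIntegral_congr_fun measurableSet_Ioc fun x hx => ?_
    simp only [hpExt_of_le_one hx.2]
  have e2 : ∫ x in (1:ℝ)..2, g x * hpExt u x = 0 := by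
    rw [intervalIntegral.integral_of_le one_le_two]
    refine (setIntegral_congr_fun measurableSet_Ioc fun x hx => ?_).trans
      (by simp : ∫ x in Ioc (1:ℝ) 2, (0:ℂ) = 0)
    simp only [hpExt_of_one_lt hx.1, mul_zero]
  rw [e1, e2, add_zero]

/-- `∫₀² ‖hpExt u‖² = ∫₀¹ ‖u‖²` (the `L²` norm of the zero extension on the period cell). [cite: Katznelson2004, Ch. I §5.5] -/
theorem integral_normSq_hpExt (hu2 : IntervalIntegrable (fun x => ‖u x‖ ^ 2) volume 0 1) :
    ∫ x in (0:ℝ)..2, ‖hpExt u x‖ ^ 2 = ∫ x in (0:ℝ)..1, ‖u x‖ ^ 2 := by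
  have h01 : IntervalIntegrable (fun x => ‖hpExt u x‖ ^ 2) volume 0 1 := by
    refine (intervalIntegrable_iff.2 ((intervalIntegrable_iff.1 hu2).congr_fun (fun x hx => ?_)
      measurableSet_uIoc))
    rw [uIoc_of_le zero_le_one] at hx
    simp only [hpExt_of_le_one hx.2]
  have h12 : IntervalIntegrable (fun x => ‖hpExt u x‖ ^ 2) volume 1 2 := by
    refine (intervalIntegrable_iff.2 ((intervalIntegrable_iff.1
      (intervalIntegrable_const (c := (0:ℝ)))).congr_fun (fun x hx => ?_) measurableSet_uIoc))
    rw [uIoc_of_le one_le_two] at hx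
    simp only [hpExt_of_one_lt hx.1, norm_zero]
    norm_num
  rw [← intervalIntegral.integral_add_adjacent_intervals h01 h12]
  have e1 : ∫ x in (0:ℝ)..1, ‖hpExt u x‖ ^ 2 = ∫ x in (0:ℝ)..1, ‖u x‖ ^ 2 := by
    rw [intervalIntegral.integral_of_le zero_le_one, intervalIntegral.integral_of_le zero_le_one]
    refine setIntegral_congr_fun measurableSet_Ioc fun x hx => ?_
    simp only [hpExt_of_le_one hx.2]
  have e2 : ∫ x in (1:ℝ)..2, ‖hpExt u x‖ ^ 2 = 0 := by
    rw [intervalIntegral.integral_of_le one_le_two]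
    refine (setIntegral_congr_fun measurableSet_Ioc fun x hx => ?_).trans
      (by simp : ∫ x in Ioc (1:ℝ) 2, (0:ℝ) = 0)
    simp only [hpExt_of_one_lt hx.1, norm_zero]
    norm_num
  rw [e1, e2, add_zero]

/-- `hpExt u` is square integrable on the period cell `(0, 2]` (an element of `L²` of the period-`2` circle). [cite: Katznelson2004, Ch. I §5.5] -/
theorem memLp_two_hpExt (hu : Measurable u)
    (hu2 : IntervalIntegrable (fun x => ‖u x‖ ^ 2) volume 0 1) :
    MemLp (hpExt u) 2 (volume.restrict (Ioc (0:ℝ) 2)) := by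
  rw [memLp_two_iff_integrable_sq_norm (measurable_hpExt hu).aestronglyMeasurable]
  have h01 : IntervalIntegrable (fun x => ‖hpExt u x‖ ^ 2) volume 0 1 := by
    refine (intervalIntegrable_iff.2 ((intervalIntegrable_iff.1 hu2).congr_fun (fun x hx => ?_)
      measurableSet_uIoc))
    rw [uIoc_of_le zero_le_one] at hx
    simp only [hpExt_of_le_one hx.2]
  have h12 : IntervalIntegrable (fun x => ‖hpExt u x‖ ^ 2) volume 1 2 := by
    refine (intervalIntegrable_iff.2 ((intervalIntegrable_iff.1
      (intervalIntegrable_const (c := (0:ℝ)))).congr_fun (fun x hx => ?_) measurableSet_uIoc))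
    rw [uIoc_of_le one_le_two] at hx
    simp only [hpExt_of_one_lt hx.1, norm_zero]
    norm_num
  have h := h01.trans h12
  rwa [intervalIntegrable_iff_integrableOn_Ioc_of_le (by norm_num)] at h

/-- Conversely `u ∈ L²(0,1]` gives `∫₀¹ ‖u‖² < ∞` as an interval-integrability statement. [folklore] -/
private theorem sq_intervalIntegrable_of_memLp_two (hu : Measurable u)
    (h : MemLp u 2 (volume.restrict (Ioc (0:ℝ) 1))) :
    IntervalIntegrable (fun x => ‖u x‖ ^ 2) volume 0 1 := by
  rw [memLp_two_iff_integrable_sq_norm hu.aestronglyMeasurable] at h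
  rwa [intervalIntegrable_iff_integrableOn_Ioc_of_le zero_le_one]

/-- **Master formula:** the `ξ`-th Fourier coefficient of the zero extension on `(0,2]` is half the
half-period coefficient: `(hpExt u)^_{(0,2]}(ξ) = ½ û(ξ)` (`⟨f, e^{int}⟩ = f̂(n)` of Thm 5.5 on the period-`2` cell).
[cite: Katznelson2004, Ch. I §5.5] -/
theorem fourierCoeffOn_hpExt (hui : IntervalIntegrable u volume 0 1) (ξ : ℤ) :
    fourierCoeffOn (two_pos : (0:ℝ) < 2) (hpExt u) ξ = (1 / 2 : ℂ) * hpCoeff u ξ := by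
  rw [fourierCoeffOn_eq_integral]
  simp_rw [fourier_neg_coe_eq_hpKer, smul_eq_mul]
  rw [integral_mul_hpExt (hpKer ξ) (continuous_hpKer ξ) hui, hpCoeff]
  have : (∫ x in (0:ℝ)..1, hpKer ξ x * u x) = ∫ x in (0:ℝ)..1, u x * hpKer ξ x :=
    intervalIntegral.integral_congr fun x _ => mul_comm _ _
  rw [this]
  norm_num

/-! ### Parseval: squared form -/

/-- **Parseval on a half period, squared form:** for `u : ℝ → ℂ` measurable with `∫₀¹ ‖u‖² < ∞`,
`Σ_{ξ∈ℤ} ‖∫₀¹ u(x)e^{-iπξx}dx‖² = 2 ∫₀¹ ‖u(x)‖² dx` (the integer-frequency exponentials `e^{iπξx}` form a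
tight frame of `L²(0,1)` with constant `2` = an orthonormal basis of `L²(0,2)` seen on half the period;
Thm 5.5 (a) on the period-`2` circle applied to the zero extension). [cite: Katznelson2004, Ch. I §5, Lemma 5.4 (Parseval) and Thm 5.5] -/
theorem hasSum_sq_hpCoeff (hu : Measurable u)
    (hu2 : IntervalIntegrable (fun x => ‖u x‖ ^ 2) volume 0 1) :
    HasSum (fun ξ : ℤ => ‖hpCoeff u ξ‖ ^ 2) (2 * ∫ x in (0:ℝ)..1, ‖u x‖ ^ 2) := by
  have hui := intervalIntegrable_of_sq hu hu2
  have h := hasSum_sq_fourierCoeffOn (two_pos : (0:ℝ) < 2) (memLp_two_hpExt hu hu2)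
  rw [integral_normSq_hpExt hu2, smul_eq_mul] at h
  simp_rw [fourierCoeffOn_hpExt hui, norm_mul] at h
  have hn : ‖(1 / 2 : ℂ)‖ = 1 / 2 := by simp
  simp_rw [hn] at h
  have h4 := h.mul_left 4
  have e1 : (fun i : ℤ => 4 * (1 / 2 * ‖hpCoeff u i‖) ^ 2) = fun ξ => ‖hpCoeff u ξ‖ ^ 2 := by
    funext ξ
    ring
  have e2 : (4 : ℝ) * ((2 - 0)⁻¹ * ∫ x in (0:ℝ)..1, ‖u x‖ ^ 2) = 2 * ∫ x in (0:ℝ)..1, ‖u x‖ ^ 2 := by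
    ring
  rw [e1, e2] at h4
  exact h4

/-- Parseval, squared form, as an equation: `∑' ξ, ‖û(ξ)‖² = 2 ∫₀¹ ‖u‖²`. [cite: Katznelson2004, Ch. I §5, Lemma 5.4 (Parseval) and Thm 5.5] -/
theorem tsum_sq_hpCoeff (hu : Measurable u)
    (hu2 : IntervalIntegrable (fun x => ‖u x‖ ^ 2) volume 0 1) :
    ∑' ξ : ℤ, ‖hpCoeff u ξ‖ ^ 2 = 2 * ∫ x in (0:ℝ)..1, ‖u x‖ ^ 2 :=
  (hasSum_sq_hpCoeff hu hu2).tsum_eq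

/-- The coefficients of an `L²` function are square summable (Bessel/Parseval). [cite: Katznelson2004, Ch. I §5, Lemma 5.4 (Parseval) and Thm 5.5] -/
theorem summable_sq_hpCoeff (hu : Measurable u)
    (hu2 : IntervalIntegrable (fun x => ‖u x‖ ^ 2) volume 0 1) :
    Summable (fun ξ : ℤ => ‖hpCoeff u ξ‖ ^ 2) :=
  (hasSum_sq_hpCoeff hu hu2).summable

/-! ### Parseval: polarised form -/

/-- A real interval-integrable function is interval integrable as a complex-valued function. [folklore] -/
private theorem intervalIntegrable_ofReal {f : ℝ → ℝ} {a b : ℝ} (h : IntervalIntegrable f volume a b) :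
    IntervalIntegrable (fun x => (f x : ℂ)) volume a b :=
  intervalIntegrable_iff.2 ((intervalIntegrable_iff.1 h).ofReal)

/-- The polarisation identity in `ℂ`: `4 a b̄ = (|a+b|² − |a−b|²) + i(|a+ib|² − |a−ib|²)`. [folklore] -/
private theorem four_mul_mul_conj_eq_polarization (a b : ℂ) :
    4 * (a * conj b) = ((‖a + b‖ ^ 2 : ℝ) : ℂ) - ((‖a - b‖ ^ 2 : ℝ) : ℂ)
      + I * (((‖a + I * b‖ ^ 2 : ℝ) : ℂ) - ((‖a - I * b‖ ^ 2 : ℝ) : ℂ)) := by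
  have h : ∀ z : ℂ, ((‖z‖ ^ 2 : ℝ) : ℂ) = z * conj z := fun z => by
    rw [Complex.mul_conj']
    norm_cast
  rw [h, h, h, h]
  simp only [map_add, map_sub, map_mul, Complex.conj_I]
  linear_combination (2 * (a * conj b - conj a * b)) * Complex.I_sq

/-- Sums of square-integrable functions are square integrable (interval form on `[0,1]`). [folklore] -/
private theorem sq_intervalIntegrable_add (hu : Measurable u) (hv : Measurable v)
    (hu2 : IntervalIntegrable (fun x => ‖u x‖ ^ 2) volume 0 1)
    (hv2 : IntervalIntegrable (fun x => ‖v x‖ ^ 2) volume 0 1) :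
    IntervalIntegrable (fun x => ‖u x + v x‖ ^ 2) volume 0 1 :=
  sq_intervalIntegrable_of_memLp_two (hu.add hv)
    ((memLp_two_of_sq hu hu2).add (memLp_two_of_sq hv hv2))

/-- Differences of square-integrable functions are square integrable (interval form on `[0,1]`). [folklore] -/
private theorem sq_intervalIntegrable_sub (hu : Measurable u) (hv : Measurable v)
    (hu2 : IntervalIntegrable (fun x => ‖u x‖ ^ 2) volume 0 1)
    (hv2 : IntervalIntegrable (fun x => ‖v x‖ ^ 2) volume 0 1) :
    IntervalIntegrable (fun x => ‖u x - v x‖ ^ 2) volume 0 1 :=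
  sq_intervalIntegrable_of_memLp_two (hu.sub hv)
    ((memLp_two_of_sq hu hu2).sub (memLp_two_of_sq hv hv2))

/-- Scalar multiples of square-integrable functions are square integrable (interval form on `[0,1]`).
[folklore] -/
private theorem sq_intervalIntegrable_const_mul (c : ℂ)
    (hv2 : IntervalIntegrable (fun x => ‖v x‖ ^ 2) volume 0 1) :
    IntervalIntegrable (fun x => ‖c * v x‖ ^ 2) volume 0 1 := by
  have h := hv2.const_mul (‖c‖ ^ 2)
  refine h.congr fun x _ => ?_
  simp only [norm_mul]
  ring

/-- `∫₀¹ u v̄` is polarised by the four squared norms: `4 ∫₀¹ u v̄ = (∫‖u+v‖² − ∫‖u−v‖²) + i(∫‖u+iv‖² − ∫‖u−iv‖²)`.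
[folklore] -/
private theorem four_mul_integral_mul_conj_eq_polarization (hu : Measurable u) (hv : Measurable v)
    (hu2 : IntervalIntegrable (fun x => ‖u x‖ ^ 2) volume 0 1)
    (hv2 : IntervalIntegrable (fun x => ‖v x‖ ^ 2) volume 0 1) :
    4 * (∫ x in (0:ℝ)..1, u x * conj (v x))
      = (((∫ x in (0:ℝ)..1, ‖u x + v x‖ ^ 2 : ℝ) : ℂ) - ((∫ x in (0:ℝ)..1, ‖u x - v x‖ ^ 2 : ℝ) : ℂ))
        + I * (((∫ x in (0:ℝ)..1, ‖u x + I * v x‖ ^ 2 : ℝ) : ℂ)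
          - ((∫ x in (0:ℝ)..1, ‖u x - I * v x‖ ^ 2 : ℝ) : ℂ)) := by
  have hIv : Measurable (fun x => I * v x) := measurable_const.mul hv
  have hIv2 : IntervalIntegrable (fun x => ‖I * v x‖ ^ 2) volume 0 1 :=
    sq_intervalIntegrable_const_mul I hv2
  have i1 := sq_intervalIntegrable_add hu hv hu2 hv2
  have i2 := sq_intervalIntegrable_sub hu hv hu2 hv2
  have i3 := sq_intervalIntegrable_add hu hIv hu2 hIv2
  have i4 := sq_intervalIntegrable_sub hu hIv hu2 hIv2
  -- complexify the four real integrals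
  rw [← intervalIntegral.integral_ofReal, ← intervalIntegral.integral_ofReal,
    ← intervalIntegral.integral_ofReal, ← intervalIntegral.integral_ofReal,
    ← intervalIntegral.integral_sub (intervalIntegrable_ofReal i1) (intervalIntegrable_ofReal i2), ← intervalIntegral.integral_sub (intervalIntegrable_ofReal i3) (intervalIntegrable_ofReal i4),
    ← intervalIntegral.integral_const_mul, ← intervalIntegral.integral_const_mul,
    ← intervalIntegral.integral_add ((intervalIntegrable_ofReal i1).sub (intervalIntegrable_ofReal i2)) (((intervalIntegrable_ofReal i3).sub (intervalIntegrable_ofReal i4)).const_mul I)]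
  refine intervalIntegral.integral_congr fun x _ => ?_
  exact four_mul_mul_conj_eq_polarization (u x) (v x)

/-- **Parseval on a half period, polarised form:** for `u, v : ℝ → ℂ` measurable with `∫₀¹ ‖u‖², ∫₀¹ ‖v‖² < ∞`,
`Σ_{ξ∈ℤ} û(ξ)·conj v̂(ξ) = 2 ∫₀¹ u(x)·conj v(x) dx`, i.e. `⟨u,v⟩_{L²(0,1)} = ½ Σ_{ξ∈ℤ} û(ξ) conj v̂(ξ)`
(Lemma 5.4 for the complete orthonormal system of Thm 5.5, transported to half a period; proved here from the
squared form by polarisation). [cite: Katznelson2004, Ch. I §5, Lemma 5.4 (Parseval) and Thm 5.5] -/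
theorem hasSum_hpCoeff_mul_conj (hu : Measurable u) (hv : Measurable v)
    (hu2 : IntervalIntegrable (fun x => ‖u x‖ ^ 2) volume 0 1)
    (hv2 : IntervalIntegrable (fun x => ‖v x‖ ^ 2) volume 0 1) :
    HasSum (fun ξ : ℤ => hpCoeff u ξ * conj (hpCoeff v ξ)) (2 * ∫ x in (0:ℝ)..1, u x * conj (v x)) := by
  have hui := intervalIntegrable_of_sq hu hu2
  have hvi := intervalIntegrable_of_sq hv hv2
  have hIv : Measurable (fun x => I * v x) := measurable_const.mul hv
  have hIv2 : IntervalIntegrable (fun x => ‖I * v x‖ ^ 2) volume 0 1 :=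
    sq_intervalIntegrable_const_mul I hv2
  have hIvi := intervalIntegrable_of_sq hIv hIv2
  -- the four squared Parseval identities, complexified
  have P1 := (hasSum_sq_hpCoeff (u := fun x => u x + v x) (hu.add hv)
    (sq_intervalIntegrable_add hu hv hu2 hv2)).mapL Complex.ofRealCLM
  have P2 := (hasSum_sq_hpCoeff (u := fun x => u x - v x) (hu.sub hv)
    (sq_intervalIntegrable_sub hu hv hu2 hv2)).mapL Complex.ofRealCLM
  have P3 := (hasSum_sq_hpCoeff (u := fun x => u x + I * v x) (hu.add hIv)
    (sq_intervalIntegrable_add hu hIv hu2 hIv2)).mapL Complex.ofRealCLM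
  have P4 := (hasSum_sq_hpCoeff (u := fun x => u x - I * v x) (hu.sub hIv)
    (sq_intervalIntegrable_sub hu hIv hu2 hIv2)).mapL Complex.ofRealCLM
  simp only [Complex.ofRealCLM_apply] at P1 P2 P3 P4
  -- combine: ((P1 - P2) + I • (P3 - P4)) / 4
  have P := ((P1.sub P2).add ((P3.sub P4).mul_left I)).mul_left (1 / 4 : ℂ)
  have e1 : (fun i : ℤ => (1 / 4 : ℂ) *
      ((((‖hpCoeff (fun x => u x + v x) i‖ ^ 2 : ℝ) : ℂ) - ((‖hpCoeff (fun x => u x - v x) i‖ ^ 2 : ℝ) : ℂ))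
        + I * ((((‖hpCoeff (fun x => u x + I * v x) i‖ ^ 2 : ℝ) : ℂ))
          - ((‖hpCoeff (fun x => u x - I * v x) i‖ ^ 2 : ℝ) : ℂ))))
      = fun ξ => hpCoeff u ξ * conj (hpCoeff v ξ) := by
    funext ξ
    rw [hpCoeff_add hui hvi, hpCoeff_sub hui hvi, hpCoeff_add hui hIvi, hpCoeff_sub hui hIvi,
      hpCoeff_const_mul]
    linear_combination (-(1 / 4 : ℂ)) * four_mul_mul_conj_eq_polarization (hpCoeff u ξ) (hpCoeff v ξ)
  have e2 : (1 / 4 : ℂ) *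
      ((((2 * ∫ x in (0:ℝ)..1, ‖u x + v x‖ ^ 2 : ℝ) : ℂ) - ((2 * ∫ x in (0:ℝ)..1, ‖u x - v x‖ ^ 2 : ℝ) : ℂ))
        + I * ((((2 * ∫ x in (0:ℝ)..1, ‖u x + I * v x‖ ^ 2 : ℝ) : ℂ))
          - ((2 * ∫ x in (0:ℝ)..1, ‖u x - I * v x‖ ^ 2 : ℝ) : ℂ)))
      = 2 * ∫ x in (0:ℝ)..1, u x * conj (v x) := by
    have h := four_mul_integral_mul_conj_eq_polarization hu hv hu2 hv2
    push_cast
    linear_combination (-(1 / 2 : ℂ)) * h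
  rw [e1, e2] at P
  exact P

/-- Parseval, polarised form, as an equation: `∑' ξ, û(ξ) conj v̂(ξ) = 2 ∫₀¹ u v̄` (Lemma 5.4 for the system of Thm 5.5). [cite: Katznelson2004, Ch. I §5, Lemma 5.4 (Parseval) and Thm 5.5] -/
theorem tsum_hpCoeff_mul_conj (hu : Measurable u) (hv : Measurable v)
    (hu2 : IntervalIntegrable (fun x => ‖u x‖ ^ 2) volume 0 1)
    (hv2 : IntervalIntegrable (fun x => ‖v x‖ ^ 2) volume 0 1) :
    ∑' ξ : ℤ, hpCoeff u ξ * conj (hpCoeff v ξ) = 2 * ∫ x in (0:ℝ)..1, u x * conj (v x) :=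
  (hasSum_hpCoeff_mul_conj hu hv hu2 hv2).tsum_eq

/-- The inner product of `L²(0,1)` from the half-period coefficients:
`∫₀¹ u v̄ = ½ ∑' ξ, û(ξ) conj v̂(ξ)` (Lemma 5.4 for the system of Thm 5.5, half period). [cite: Katznelson2004, Ch. I §5, Lemma 5.4 (Parseval) and Thm 5.5] -/
theorem integral_mul_conj_eq_half_tsum (hu : Measurable u) (hv : Measurable v)
    (hu2 : IntervalIntegrable (fun x => ‖u x‖ ^ 2) volume 0 1)
    (hv2 : IntervalIntegrable (fun x => ‖v x‖ ^ 2) volume 0 1) :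
    ∫ x in (0:ℝ)..1, u x * conj (v x) = (1 / 2 : ℂ) * ∑' ξ : ℤ, hpCoeff u ξ * conj (hpCoeff v ξ) := by
  rw [tsum_hpCoeff_mul_conj hu hv hu2 hv2]
  ring

end Literature.Analysis.Fourier

namespace Literature.Analysis.Fourier

/-! ### Part 2 (v2) — `L²` hypothesis shape, continuous data, and twisted frequencies `ξ + θ`

Appended for the users in `Literature/NumberTheory/LFunctions/Zhang2022/` (E-102 head 2, pieces P2–P4):
there the data are a profile derivative `g′ ∈ L²(0,1]` handed over as
`MemLp g′ 2 (volume.restrict (Ioc 0 1))` (`Repair.KinkedProfile.memLp`, no global measurability) and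
continuous `g`, `∫_y^1 g` on `[0,1]`; and the frequency sum is wanted over every coset `θ + ℤ`.
(v2.1) the polarised Parseval identity on a general period cell `(c, c+T]` for Mathlib's
`fourierCoeffOn` under `MemLp` hypotheses (Lemma I.5.4 for the Hilbert basis `fourierBasis` of
`L²(AddCircle T)`; adapted from the tree's `Summit.RiemannHypothesis.RiemannHypothesis.Theorems.
soloBlind_hasSum_conj_fourierCoeffOn_mul`, which a Literature file may not import);
(v2.2) the half-period identities of Part 1 under `MemLp u 2 (volume.restrict (Ioc 0 1))` instead of
`Measurable u ∧ ∫₀¹‖u‖² < ∞` (`…_of_memLp`), and for data continuous on `[0,1]` (`…_of_continuousOn`,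
mixed `L² × C⁰` pairings);
(v2.3) TWISTED frequencies: for every real `θ`,
`Σ_{ξ∈ℤ} û(ξ+θ)·conj v̂(ξ+θ) = 2∫₀¹ u·conj v` with `û(x) = ∫₀¹ u(y)e^{-iπxy}dy` at REAL `x` — the system
`{e^{iπ(ξ+θ)x}/√2}_ξ` is again an orthonormal basis of `L²(0,2)`; here obtained from `θ = 0` applied
to `u·e^{-iπθx}` (`hpCoeff_twist`: the `ξ`-th coefficient of the twisted function IS the
`(ξ+θ)`-frequency integral). Source as in Part 1: [Katznelson2004, Ch. I §5, Lemma 5.4 and Thm 5.5];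
plumbing private. -/

open AddCircle
open scoped InnerProductSpace

variable {u v : ℝ → ℂ}

/-! #### v2.1 Polarised Parseval on a period cell `(c, c + T]` under `MemLp` -/

/-- **Polarised Parseval identity on a period cell.** For `f, g ∈ L²(c, c+T]`,
`∑_{i ∈ ℤ} conj (ĉ_i f) · ĉ_i g = T⁻¹ ∫_c^{c+T} conj f · g` as an unconditional `HasSum`, where
`ĉ_i = fourierCoeffOn` are Mathlib's Fourier coefficients of period `T` (Lemma 5.4 for the complete
orthonormal system of Thm 5.5 = Mathlib's `fourierBasis`; Mathlib's `hasSum_sq_fourierCoeffOn` is the case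
`f = g`). [cite: Katznelson2004, Ch. I §5, Lemma 5.4 (Parseval) and Thm 5.5] -/
theorem hasSum_conj_fourierCoeffOn_mul {c T : ℝ} (hT : 0 < T) {f g : ℝ → ℂ}
    (hf : MemLp f 2 (volume.restrict (Ioc c (c + T))))
    (hg : MemLp g 2 (volume.restrict (Ioc c (c + T)))) :
    HasSum (fun i : ℤ => conj (fourierCoeffOn (lt_add_of_pos_right c hT) f i) *
        fourierCoeffOn (lt_add_of_pos_right c hT) g i)
      (T⁻¹ • ∫ x in c..c + T, conj (f x) * g x) := by
  -- adapted from Summits/RiemannHypothesis/RiemannHypothesis/Theorems/SoloBlindLatticeBlind.lean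
  -- (`soloBlind_hasSum_conj_fourierCoeffOn_mul`), which Literature files may not import.
  haveI : Fact (0 < T) := ⟨hT⟩
  have hF := hf.memLp_liftIoc.haarAddCircle
  have hG := hg.memLp_liftIoc.haarAddCircle
  have key := (fourierBasis (T := T)).hasSum_inner_mul_inner hF.toLp hG.toLp
  have hcf : ∀ i : ℤ, fourierCoeff (hF.toLp : Lp ℂ 2 (haarAddCircle (T := T))) i =
      fourierCoeffOn (lt_add_of_pos_right c hT) f i := fun i => by
    rw [fourierCoeff_congr_ae hF.coeFn_toLp, fourierCoeff_liftIoc_eq]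
  have hcg : ∀ i : ℤ, fourierCoeff (hG.toLp : Lp ℂ 2 (haarAddCircle (T := T))) i =
      fourierCoeffOn (lt_add_of_pos_right c hT) g i := fun i => by
    rw [fourierCoeff_congr_ae hG.coeFn_toLp, fourierCoeff_liftIoc_eq]
  have hsummand : ∀ i : ℤ,
      ⟪hF.toLp, fourierBasis (T := T) i⟫_ℂ * ⟪fourierBasis (T := T) i, hG.toLp⟫_ℂ =
      conj (fourierCoeffOn (lt_add_of_pos_right c hT) f i) *
        fourierCoeffOn (lt_add_of_pos_right c hT) g i := fun i => by
    rw [← hcf, ← hcg, ← fourierBasis_repr, ← fourierBasis_repr, HilbertBasis.repr_apply_apply,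
      HilbertBasis.repr_apply_apply, inner_conj_symm]
  have hval : ⟪hF.toLp, hG.toLp⟫_ℂ = T⁻¹ • ∫ x in c..c + T, conj (f x) * g x := by
    rw [L2.inner_def]
    have hae : (fun t : AddCircle T =>
        ⟪(hF.toLp : AddCircle T → ℂ) t, (hG.toLp : AddCircle T → ℂ) t⟫_ℂ) =ᵐ[haarAddCircle]
        liftIoc T c (fun x => conj (f x) * g x) := by
      filter_upwards [hF.coeFn_toLp, hG.coeFn_toLp] with t h1 h2
      rw [h1, h2, RCLike.inner_apply']
      rfl
    rw [integral_congr_ae hae, AddCircle.integral_haarAddCircle,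
      AddCircle.integral_liftIoc_eq_intervalIntegral]
  simpa only [hsummand, hval] using key

/-! #### v2.2 The half-period identities under `MemLp`, and for continuous data -/

/-- The zero extension is an indicator. [folklore] -/
private theorem hpExt_eq_indicator (u : ℝ → ℂ) : hpExt u = Set.indicator (Set.Iic 1) u := by
  funext x
  by_cases hx : x ≤ 1
  · rw [Set.indicator_of_mem (show x ∈ Set.Iic (1:ℝ) from hx)]
    simp [hpExt, hx]
  · rw [Set.indicator_of_notMem (show x ∉ Set.Iic (1:ℝ) from hx)]
    simp [hpExt, hx]

/-- `hpExt u ∈ L²` of the cell `(0, 0+2]` when `u ∈ L²(0,1]` (no measurability of `u` on `ℝ` needed).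
[folklore] -/
private theorem memLp_hpExt_of_memLp (hu : MemLp u 2 (volume.restrict (Ioc 0 1))) :
    MemLp (hpExt u) 2 (volume.restrict (Ioc (0:ℝ) (0 + 2))) := by
  rw [hpExt_eq_indicator, memLp_indicator_iff_restrict measurableSet_Iic,
    Measure.restrict_restrict measurableSet_Iic, zero_add, Iic_inter_Ioc_of_le one_le_two]
  exact hu

/-- `u ∈ L²(0,1]` is integrable on `[0,1]`. [folklore] -/
private theorem intervalIntegrable_of_memLp_two (hu : MemLp u 2 (volume.restrict (Ioc 0 1))) :
    IntervalIntegrable u volume 0 1 := by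
  rw [intervalIntegrable_iff_integrableOn_Ioc_of_le zero_le_one]
  exact hu.integrable one_le_two

/-- The cell pairing of two zero extensions is the half-period pairing:
`∫₀^{0+2} conj (hpExt u) · hpExt v = ∫₀¹ conj u · v`. [folklore] -/
private theorem integral_conj_hpExt_mul_hpExt (u v : ℝ → ℂ) :
    ∫ x in (0:ℝ)..0 + 2, conj (hpExt u x) * hpExt v x = ∫ x in (0:ℝ)..1, conj (u x) * v x := by
  have h : (fun x => conj (hpExt u x) * hpExt v x) =
      Set.indicator {x : ℝ | x ≤ 1} (fun x => conj (u x) * v x) := by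
    funext x
    by_cases hx : x ≤ 1
    · rw [Set.indicator_of_mem (show x ∈ {x : ℝ | x ≤ 1} from hx)]
      simp [hpExt, hx]
    · rw [Set.indicator_of_notMem (show x ∉ {x : ℝ | x ≤ 1} from hx)]
      simp [hpExt, hx]
  rw [zero_add, h]
  exact intervalIntegral.integral_indicator ⟨zero_le_one, one_le_two⟩

/-- A function continuous on `[0,1]` is in `L²(0,1]`. [folklore] -/
private theorem memLp_two_Ioc_of_continuousOn (hu : ContinuousOn u (Icc 0 1)) :
    MemLp u 2 (volume.restrict (Ioc (0:ℝ) 1)) := by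
  have hmeas : AEStronglyMeasurable u (volume.restrict (Ioc (0:ℝ) 1)) :=
    (hu.mono Ioc_subset_Icc_self).aestronglyMeasurable measurableSet_Ioc
  rw [memLp_two_iff_integrable_sq_norm hmeas]
  have hc : ContinuousOn (fun y => ‖u y‖ ^ 2) (Icc 0 1) := (hu.norm).pow 2
  exact hc.integrableOn_Icc.mono_set Ioc_subset_Icc_self

/-- **Parseval on a half period, polarised, `L²` hypothesis shape** (conjugate on the FIRST factor):
for `u, v ∈ L²(0,1]`, `Σ_{ξ∈ℤ} conj û(ξ) · v̂(ξ) = 2∫₀¹ conj u · v` — Lemma 5.4 for the system of Thm 5.5 on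
the period-`2` circle applied to the zero extensions (direct Hilbert-basis proof; no measurability of
`u, v` on `ℝ` is assumed). [cite: Katznelson2004, Ch. I §5, Lemma 5.4 (Parseval) and Thm 5.5] -/
theorem hasSum_conj_hpCoeff_mul_of_memLp (hu : MemLp u 2 (volume.restrict (Ioc 0 1)))
    (hv : MemLp v 2 (volume.restrict (Ioc 0 1))) :
    HasSum (fun ξ : ℤ => conj (hpCoeff u ξ) * hpCoeff v ξ)
      (2 * ∫ x in (0:ℝ)..1, conj (u x) * v x) := by
  have h := hasSum_conj_fourierCoeffOn_mul two_pos (memLp_hpExt_of_memLp hu)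
    (memLp_hpExt_of_memLp hv)
  have h2 : ∀ (w : ℝ → ℂ), MemLp w 2 (volume.restrict (Ioc 0 1)) → ∀ ξ : ℤ,
      fourierCoeffOn (lt_add_of_pos_right (0:ℝ) two_pos) (hpExt w) ξ = (1 / 2 : ℂ) * hpCoeff w ξ :=
    fun w hw ξ => by
      rw [← fourierCoeffOn_hpExt (intervalIntegrable_of_memLp_two hw)]
      congr 1
      norm_num
  simp_rw [h2 u hu, h2 v hv, integral_conj_hpExt_mul_hpExt, Complex.real_smul] at h
  have h4 := h.mul_left 4
  have e1 : (fun ξ : ℤ => conj (hpCoeff u ξ) * hpCoeff v ξ) =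
      fun ξ : ℤ => 4 * (conj ((1 / 2 : ℂ) * hpCoeff u ξ) * ((1 / 2 : ℂ) * hpCoeff v ξ)) := by
    funext ξ
    simp only [map_mul, map_div₀, map_one]
    rw [show conj (2:ℂ) = 2 from Complex.conj_ofNat 2]
    ring
  have e2 : (2 * ∫ x in (0:ℝ)..1, conj (u x) * v x) =
      4 * ((((2:ℝ)⁻¹ : ℝ) : ℂ) * ∫ x in (0:ℝ)..1, conj (u x) * v x) := by
    push_cast
    ring
  rw [e1, e2]
  exact h4

/-- **Parseval on a half period, polarised, `L²` hypothesis shape** (the orientation of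
`hasSum_hpCoeff_mul_conj`): `Σ_{ξ∈ℤ} û(ξ)·conj v̂(ξ) = 2∫₀¹ u·conj v` for `u, v ∈ L²(0,1]`.
[cite: Katznelson2004, Ch. I §5, Lemma 5.4 (Parseval) and Thm 5.5] -/
theorem hasSum_hpCoeff_mul_conj_of_memLp (hu : MemLp u 2 (volume.restrict (Ioc 0 1)))
    (hv : MemLp v 2 (volume.restrict (Ioc 0 1))) :
    HasSum (fun ξ : ℤ => hpCoeff u ξ * conj (hpCoeff v ξ)) (2 * ∫ x in (0:ℝ)..1, u x * conj (v x)) := by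
  have h := hasSum_conj_hpCoeff_mul_of_memLp hv hu
  simp_rw [mul_comm (conj (hpCoeff v _)) _] at h
  rw [show (2 * ∫ x in (0:ℝ)..1, u x * conj (v x)) = 2 * ∫ x in (0:ℝ)..1, conj (v x) * u x from by
    congr 1
    exact intervalIntegral.integral_congr fun x _ => by ring]
  exact h

/-- **Parseval on a half period, squared form, `L²` hypothesis shape:** `Σ_{ξ∈ℤ} ‖û(ξ)‖² = 2∫₀¹ ‖u‖²`
for `u ∈ L²(0,1]` (Thm 5.5 (a) on the period-`2` circle for the zero extension).
[cite: Katznelson2004, Ch. I §5, Lemma 5.4 (Parseval) and Thm 5.5] -/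
theorem hasSum_sq_hpCoeff_of_memLp (hu : MemLp u 2 (volume.restrict (Ioc 0 1))) :
    HasSum (fun ξ : ℤ => ‖hpCoeff u ξ‖ ^ 2) (2 * ∫ x in (0:ℝ)..1, ‖u x‖ ^ 2) := by
  have h := hasSum_conj_hpCoeff_mul_of_memLp hu hu
  simp_rw [Complex.conj_mul'] at h
  have e1 : (fun ξ : ℤ => ((‖hpCoeff u ξ‖ : ℂ)) ^ 2) =
      fun ξ : ℤ => (((‖hpCoeff u ξ‖ ^ 2 : ℝ)) : ℂ) := by
    funext ξ
    push_cast
    rfl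
  have e2 : (2 * ∫ x in (0:ℝ)..1, ((‖u x‖ : ℂ)) ^ 2) =
      (((2 * ∫ x in (0:ℝ)..1, ‖u x‖ ^ 2 : ℝ)) : ℂ) := by
    rw [Complex.ofReal_mul, ← intervalIntegral.integral_ofReal]
    push_cast
    rfl
  rw [e1, e2] at h
  exact Complex.hasSum_ofReal.mp h

/-- `∑' ξ, û(ξ) conj v̂(ξ) = 2∫₀¹ u v̄` for `u, v ∈ L²(0,1]`.
[cite: Katznelson2004, Ch. I §5, Lemma 5.4 (Parseval) and Thm 5.5] -/
theorem tsum_hpCoeff_mul_conj_of_memLp (hu : MemLp u 2 (volume.restrict (Ioc 0 1)))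
    (hv : MemLp v 2 (volume.restrict (Ioc 0 1))) :
    ∑' ξ : ℤ, hpCoeff u ξ * conj (hpCoeff v ξ) = 2 * ∫ x in (0:ℝ)..1, u x * conj (v x) :=
  (hasSum_hpCoeff_mul_conj_of_memLp hu hv).tsum_eq

/-- `∑' ξ, ‖û(ξ)‖² = 2∫₀¹ ‖u‖²` for `u ∈ L²(0,1]`. [cite: Katznelson2004, Ch. I §5, Lemma 5.4 (Parseval) and Thm 5.5] -/
theorem tsum_sq_hpCoeff_of_memLp (hu : MemLp u 2 (volume.restrict (Ioc 0 1))) :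
    ∑' ξ : ℤ, ‖hpCoeff u ξ‖ ^ 2 = 2 * ∫ x in (0:ℝ)..1, ‖u x‖ ^ 2 :=
  (hasSum_sq_hpCoeff_of_memLp hu).tsum_eq

/-- Square summability of the coefficients of `u ∈ L²(0,1]`. [cite: Katznelson2004, Ch. I §5, Lemma 5.4 (Parseval) and Thm 5.5] -/
theorem summable_sq_hpCoeff_of_memLp (hu : MemLp u 2 (volume.restrict (Ioc 0 1))) :
    Summable (fun ξ : ℤ => ‖hpCoeff u ξ‖ ^ 2) :=
  (hasSum_sq_hpCoeff_of_memLp hu).summable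

/-- Polarised Parseval for data continuous on `[0,1]` (e.g. a profile and its primitive).
[cite: Katznelson2004, Ch. I §5, Lemma 5.4 (Parseval) and Thm 5.5] -/
theorem hasSum_hpCoeff_mul_conj_of_continuousOn (hu : ContinuousOn u (Icc 0 1))
    (hv : ContinuousOn v (Icc 0 1)) :
    HasSum (fun ξ : ℤ => hpCoeff u ξ * conj (hpCoeff v ξ)) (2 * ∫ x in (0:ℝ)..1, u x * conj (v x)) :=
  hasSum_hpCoeff_mul_conj_of_memLp (memLp_two_Ioc_of_continuousOn hu)
    (memLp_two_Ioc_of_continuousOn hv)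

/-- Polarised Parseval, mixed data: `u ∈ L²(0,1]`, `v` continuous on `[0,1]` (e.g. a second derivative
against a first derivative). [cite: Katznelson2004, Ch. I §5, Lemma 5.4 (Parseval) and Thm 5.5] -/
theorem hasSum_hpCoeff_mul_conj_of_memLp_of_continuousOn (hu : MemLp u 2 (volume.restrict (Ioc 0 1)))
    (hv : ContinuousOn v (Icc 0 1)) :
    HasSum (fun ξ : ℤ => hpCoeff u ξ * conj (hpCoeff v ξ)) (2 * ∫ x in (0:ℝ)..1, u x * conj (v x)) :=
  hasSum_hpCoeff_mul_conj_of_memLp hu (memLp_two_Ioc_of_continuousOn hv)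

/-- Polarised Parseval, mixed data: `u` continuous on `[0,1]`, `v ∈ L²(0,1]`.
[cite: Katznelson2004, Ch. I §5, Lemma 5.4 (Parseval) and Thm 5.5] -/
theorem hasSum_hpCoeff_mul_conj_of_continuousOn_of_memLp (hu : ContinuousOn u (Icc 0 1))
    (hv : MemLp v 2 (volume.restrict (Ioc 0 1))) :
    HasSum (fun ξ : ℤ => hpCoeff u ξ * conj (hpCoeff v ξ)) (2 * ∫ x in (0:ℝ)..1, u x * conj (v x)) :=
  hasSum_hpCoeff_mul_conj_of_memLp (memLp_two_Ioc_of_continuousOn hu) hv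

/-- Parseval, squared form, for data continuous on `[0,1]`.
[cite: Katznelson2004, Ch. I §5, Lemma 5.4 (Parseval) and Thm 5.5] -/
theorem hasSum_sq_hpCoeff_of_continuousOn (hu : ContinuousOn u (Icc 0 1)) :
    HasSum (fun ξ : ℤ => ‖hpCoeff u ξ‖ ^ 2) (2 * ∫ x in (0:ℝ)..1, ‖u x‖ ^ 2) :=
  hasSum_sq_hpCoeff_of_memLp (memLp_two_Ioc_of_continuousOn hu)

/-- The coefficient written with a REAL frequency variable and the kernel in the order `I·π·x·y`:
`û(ξ) = ∫₀¹ u(y) e^{-iπ ξ y} dy` with `ξ` cast through `ℝ` (the shape used by consumers who define the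
transform at real frequencies, e.g. `Zhang2022.Det.ghat`). [cite: Katznelson2004, Ch. I §5.5] -/
theorem hpCoeff_eq_integral_realFreq (u : ℝ → ℂ) (ξ : ℤ) :
    hpCoeff u ξ = ∫ y in (0:ℝ)..1, u y * Complex.exp (-(I * π * ((ξ : ℝ) : ℂ) * y)) := by
  unfold hpCoeff hpKer
  refine intervalIntegral.integral_congr fun y _ => ?_
  congr 2
  push_cast
  ring

/-- **Parseval on a half period, polarised, `L²` hypothesis shape, real-frequency spelling:** for
`u, v ∈ L²(0,1]`, `Σ_{ξ∈ℤ} (∫₀¹ u e^{-iπξy}) · conj (∫₀¹ v e^{-iπξy}) = 2∫₀¹ u·conj v` with the integrands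
spelled `u y * cexp (-(I * π * ξ * y))`, `ξ` cast through `ℝ` — the displayed hypothesis `hP` of the
Zhang2022 consumers, discharged. [cite: Katznelson2004, Ch. I §5, Lemma 5.4 (Parseval) and Thm 5.5] -/
theorem hasSum_integral_cexp_mul_conj_of_memLp (hu : MemLp u 2 (volume.restrict (Ioc 0 1)))
    (hv : MemLp v 2 (volume.restrict (Ioc 0 1))) :
    HasSum (fun ξ : ℤ => (∫ y in (0:ℝ)..1, u y * Complex.exp (-(I * π * ((ξ : ℝ) : ℂ) * y))) *
        conj (∫ y in (0:ℝ)..1, v y * Complex.exp (-(I * π * ((ξ : ℝ) : ℂ) * y))))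
      (2 * ∫ y in (0:ℝ)..1, u y * conj (v y)) := by
  have h := hasSum_hpCoeff_mul_conj_of_memLp hu hv
  simp_rw [hpCoeff_eq_integral_realFreq] at h
  exact h

/-- The same for data continuous on `[0,1]`, real-frequency spelling.
[cite: Katznelson2004, Ch. I §5, Lemma 5.4 (Parseval) and Thm 5.5] -/
theorem hasSum_integral_cexp_mul_conj_of_continuousOn (hu : ContinuousOn u (Icc 0 1))
    (hv : ContinuousOn v (Icc 0 1)) :
    HasSum (fun ξ : ℤ => (∫ y in (0:ℝ)..1, u y * Complex.exp (-(I * π * ((ξ : ℝ) : ℂ) * y))) *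
        conj (∫ y in (0:ℝ)..1, v y * Complex.exp (-(I * π * ((ξ : ℝ) : ℂ) * y))))
      (2 * ∫ y in (0:ℝ)..1, u y * conj (v y)) :=
  hasSum_integral_cexp_mul_conj_of_memLp (memLp_two_Ioc_of_continuousOn hu)
    (memLp_two_Ioc_of_continuousOn hv)

/-! #### v2.3 Twisted frequencies `ξ + θ` -/

/-- The unimodular multiplier `e_θ(x) = e^{-iπθx}` is continuous. [folklore] -/
private theorem continuous_cexp_twist (θ : ℝ) :
    Continuous fun x : ℝ => Complex.exp (-((π : ℂ) * I * θ * x)) := by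
  fun_prop

/-- `‖u(x) e^{-iπθx}‖ = ‖u(x)‖`. [folklore] -/
private theorem norm_mul_cexp_twist (u : ℝ → ℂ) (θ x : ℝ) :
    ‖u x * Complex.exp (-((π : ℂ) * I * θ * x))‖ = ‖u x‖ := by
  rw [norm_mul, show -((π : ℂ) * I * θ * x) = ((-(π * θ * x) : ℝ) : ℂ) * I by push_cast; ring,
    Complex.norm_exp_ofReal_mul_I, mul_one]

/-- Twisting preserves `L²(0,1]`. [folklore] -/
private theorem memLp_mul_cexp_twist (hu : MemLp u 2 (volume.restrict (Ioc 0 1))) (θ : ℝ) :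
    MemLp (fun x => u x * Complex.exp (-((π : ℂ) * I * θ * x))) 2 (volume.restrict (Ioc 0 1)) := by
  have hmeas : AEStronglyMeasurable (fun x => u x * Complex.exp (-((π : ℂ) * I * θ * x)))
      (volume.restrict (Ioc 0 1)) := hu.1.mul (continuous_cexp_twist θ).aestronglyMeasurable
  rw [memLp_two_iff_integrable_sq_norm hmeas]
  have hi := (memLp_two_iff_integrable_sq_norm hu.1).1 hu
  refine hi.congr (Filter.Eventually.of_forall fun x => ?_)
  simp only [norm_mul_cexp_twist]

/-- `(u e_θ)·conj (v e_θ) = u·conj v` (`|e_θ|² = 1`). [folklore] -/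
private theorem twist_mul_conj_twist (u v : ℝ → ℂ) (θ x : ℝ) :
    (u x * Complex.exp (-((π : ℂ) * I * θ * x))) * conj (v x * Complex.exp (-((π : ℂ) * I * θ * x))) =
      u x * conj (v x) := by
  have hunit : Complex.exp (-((π : ℂ) * I * θ * x)) * conj (Complex.exp (-((π : ℂ) * I * θ * x))) = 1 := by
    rw [← Complex.exp_conj, ← Complex.exp_add]
    simp only [map_neg, map_mul, Complex.conj_ofReal, Complex.conj_I]
    rw [show -(↑π * I * ↑θ * ↑x) + -(↑π * -I * ↑θ * ↑x) = (0:ℂ) by ring, Complex.exp_zero]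
  calc (u x * Complex.exp (-((π : ℂ) * I * θ * x))) * conj (v x * Complex.exp (-((π : ℂ) * I * θ * x)))
      = u x * conj (v x) *
          (Complex.exp (-((π : ℂ) * I * θ * x)) * conj (Complex.exp (-((π : ℂ) * I * θ * x)))) := by
        rw [map_mul]; ring
    _ = u x * conj (v x) := by rw [hunit, mul_one]

/-- **The twisted coefficient is the real-frequency coefficient:** for every real `θ` and `ξ ∈ ℤ`,
`(u·e^{-iπθ·})^(ξ) = ∫₀¹ u(x) e^{-iπ(ξ+θ)x} dx = û(ξ+θ)` (the system `e^{iπ(ξ+θ)x}` of the period-`2` circle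
seen on `[0,1]`). [cite: Katznelson2004, Ch. I §5.5] -/
theorem hpCoeff_twist (u : ℝ → ℂ) (θ : ℝ) (ξ : ℤ) :
    hpCoeff (fun x => u x * Complex.exp (-((π : ℂ) * I * θ * x))) ξ =
      ∫ x in (0:ℝ)..1, u x * Complex.exp (-((π : ℂ) * I * ((ξ : ℝ) + θ) * x)) := by
  unfold hpCoeff hpKer
  refine intervalIntegral.integral_congr fun x _ => ?_
  dsimp only
  rw [mul_assoc, ← Complex.exp_add]
  congr 2
  push_cast
  ring

/-- **Parseval on a half period, polarised, TWISTED frequencies:** for every real `θ` and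
`u, v : ℝ → ℂ` measurable with `∫₀¹‖u‖², ∫₀¹‖v‖² < ∞`,
`Σ_{ξ∈ℤ} û(ξ+θ)·conj v̂(ξ+θ) = 2∫₀¹ u·conj v`, `û(x) = ∫₀¹ u(y)e^{-iπxy}dy` — Lemma 5.4 for the complete
orthonormal system `{e^{iπ(ξ+θ)x}/√2}_ξ` of `L²(0,2)` (Thm 5.5 twisted by the unimodular character
`e^{iπθx}`), on the zero extensions. [cite: Katznelson2004, Ch. I §5, Lemma 5.4 (Parseval) and Thm 5.5] -/
theorem hasSum_hpCoeff_mul_conj_twist (θ : ℝ) (hu : Measurable u) (hv : Measurable v)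
    (hu2 : IntervalIntegrable (fun x => ‖u x‖ ^ 2) volume 0 1)
    (hv2 : IntervalIntegrable (fun x => ‖v x‖ ^ 2) volume 0 1) :
    HasSum (fun ξ : ℤ => (∫ x in (0:ℝ)..1, u x * Complex.exp (-((π : ℂ) * I * ((ξ : ℝ) + θ) * x))) *
        conj (∫ x in (0:ℝ)..1, v x * Complex.exp (-((π : ℂ) * I * ((ξ : ℝ) + θ) * x))))
      (2 * ∫ x in (0:ℝ)..1, u x * conj (v x)) := by
  have h := hasSum_hpCoeff_mul_conj_of_memLp (memLp_mul_cexp_twist (memLp_two_of_sq hu hu2) θ)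
    (memLp_mul_cexp_twist (memLp_two_of_sq hv hv2) θ)
  simp_rw [twist_mul_conj_twist, hpCoeff_twist] at h
  exact h

/-- **Parseval on a half period, polarised, twisted frequencies, `L²` hypothesis shape:** for every real
`θ` and `u, v ∈ L²(0,1]`, `Σ_{ξ∈ℤ} û(ξ+θ)·conj v̂(ξ+θ) = 2∫₀¹ u·conj v`.
[cite: Katznelson2004, Ch. I §5, Lemma 5.4 (Parseval) and Thm 5.5] -/
theorem hasSum_hpCoeff_mul_conj_twist_of_memLp (θ : ℝ) (hu : MemLp u 2 (volume.restrict (Ioc 0 1)))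
    (hv : MemLp v 2 (volume.restrict (Ioc 0 1))) :
    HasSum (fun ξ : ℤ => (∫ x in (0:ℝ)..1, u x * Complex.exp (-((π : ℂ) * I * ((ξ : ℝ) + θ) * x))) *
        conj (∫ x in (0:ℝ)..1, v x * Complex.exp (-((π : ℂ) * I * ((ξ : ℝ) + θ) * x))))
      (2 * ∫ x in (0:ℝ)..1, u x * conj (v x)) := by
  have h := hasSum_hpCoeff_mul_conj_of_memLp (memLp_mul_cexp_twist hu θ) (memLp_mul_cexp_twist hv θ)
  simp_rw [twist_mul_conj_twist, hpCoeff_twist] at h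
  exact h

/-- **Parseval on a half period, squared form, twisted frequencies:** for every real `θ` and `u`
measurable with `∫₀¹‖u‖² < ∞`, `Σ_{ξ∈ℤ} ‖û(ξ+θ)‖² = 2∫₀¹ ‖u‖²`.
[cite: Katznelson2004, Ch. I §5, Lemma 5.4 (Parseval) and Thm 5.5] -/
theorem hasSum_sq_hpCoeff_twist (θ : ℝ) (hu : Measurable u)
    (hu2 : IntervalIntegrable (fun x => ‖u x‖ ^ 2) volume 0 1) :
    HasSum (fun ξ : ℤ => ‖∫ x in (0:ℝ)..1, u x * Complex.exp (-((π : ℂ) * I * ((ξ : ℝ) + θ) * x))‖ ^ 2)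
      (2 * ∫ x in (0:ℝ)..1, ‖u x‖ ^ 2) := by
  have h := hasSum_sq_hpCoeff_of_memLp (memLp_mul_cexp_twist (memLp_two_of_sq hu hu2) θ)
  simp_rw [norm_mul_cexp_twist, hpCoeff_twist] at h
  exact h

/-- **Parseval on a half period, squared form, twisted frequencies, `L²` hypothesis shape:**
`Σ_{ξ∈ℤ} ‖û(ξ+θ)‖² = 2∫₀¹ ‖u‖²` for `u ∈ L²(0,1]` and every real `θ`.
[cite: Katznelson2004, Ch. I §5, Lemma 5.4 (Parseval) and Thm 5.5] -/
theorem hasSum_sq_hpCoeff_twist_of_memLp (θ : ℝ) (hu : MemLp u 2 (volume.restrict (Ioc 0 1))) :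
    HasSum (fun ξ : ℤ => ‖∫ x in (0:ℝ)..1, u x * Complex.exp (-((π : ℂ) * I * ((ξ : ℝ) + θ) * x))‖ ^ 2)
      (2 * ∫ x in (0:ℝ)..1, ‖u x‖ ^ 2) := by
  have h := hasSum_sq_hpCoeff_of_memLp (memLp_mul_cexp_twist hu θ)
  simp_rw [norm_mul_cexp_twist, hpCoeff_twist] at h
  exact h

/-- `∑' ξ, û(ξ+θ) conj v̂(ξ+θ) = 2∫₀¹ u v̄` for `u, v ∈ L²(0,1]` and every real `θ`.
[cite: Katznelson2004, Ch. I §5, Lemma 5.4 (Parseval) and Thm 5.5] -/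
theorem tsum_hpCoeff_mul_conj_twist_of_memLp (θ : ℝ) (hu : MemLp u 2 (volume.restrict (Ioc 0 1)))
    (hv : MemLp v 2 (volume.restrict (Ioc 0 1))) :
    ∑' ξ : ℤ, (∫ x in (0:ℝ)..1, u x * Complex.exp (-((π : ℂ) * I * ((ξ : ℝ) + θ) * x))) *
        conj (∫ x in (0:ℝ)..1, v x * Complex.exp (-((π : ℂ) * I * ((ξ : ℝ) + θ) * x))) =
      2 * ∫ x in (0:ℝ)..1, u x * conj (v x) :=
  (hasSum_hpCoeff_mul_conj_twist_of_memLp θ hu hv).tsum_eq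

/-- Square summability of the twisted coefficients of `u ∈ L²(0,1]`.
[cite: Katznelson2004, Ch. I §5, Lemma 5.4 (Parseval) and Thm 5.5] -/
theorem summable_sq_hpCoeff_twist_of_memLp (θ : ℝ) (hu : MemLp u 2 (volume.restrict (Ioc 0 1))) :
    Summable fun ξ : ℤ =>
      ‖∫ x in (0:ℝ)..1, u x * Complex.exp (-((π : ℂ) * I * ((ξ : ℝ) + θ) * x))‖ ^ 2 :=
  (hasSum_sq_hpCoeff_twist_of_memLp θ hu).summable

end Literature.Analysis.Fourier
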